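import Literature.MathematicalPhysics.QuantumLattice.KagomeLattice
import HarnessLib

/-!
# The kagome lattice: the `60°` rotation acts on edges of `𝕋` through `triRot60`

Topic `Literature/MathematicalPhysics/QuantumLattice`. `KagomeLattice.lean` records as the named
fact `kagomeEdge_kagomeRot60` that the rotation `kagomeRot60` of the kagome sites (the midpoints of
the edges of the triangular lattice `𝕋`; Savary–Balents, *Quantum spin liquids: a review*,
Rep. Prog. Phys. **80** (2017) 016502 — the kagomé lattice of corner-sharing triangles, §6.4.2
*Kagomé models* and §7.1.1 in the numbering of arXiv:1601.03742, pp. 39 and 44 of the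
materialised text; `KagomeLattice.lean` quotes it as §5, Fig. 12) is the map induced on the edges
of `𝕋` by the lattice rotation `R := triRot60`, `R (a, b) = (-b, a + b)` (Werner 2009, §1):
`kagomeEdge (kagomeRot60 v) = (kagomeEdge v).map R`.

This file PROVES it (`kagomeEdge_kagomeRot60_holds`, a three-case computation): `R` is additive
with `R e₀ = e₁`, `R e₁ = e₁ - e₀` (`triRot60_add_single_zero`, `triRot60_add_single_one`), so
the three edges `{x, x + e₀}`, `{x, x + e₁}`, `{x + e₀, x + e₁}` of the up triangle of the cell
`x` go to `{Rx, Rx + e₁}`, `{Rx, Rx - e₀ + e₁}`, `{Rx + e₁, Rx - e₀ + e₁}`, which are by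
definition the edges `kagomeEdge (Rx, 1)`, `kagomeEdge (Rx - e₀, 2)`, `kagomeEdge (Rx - e₀ + e₁, 0)`
of the three values of `kagomeRot60` (the last one up to the symmetry of `Sym2`).

It also PROVES the automorphism property `kagomeGraph_adj_kagomeRot60_iff`
(`kagomeGraph_adj_kagomeRot60_iff_holds`): `kagomeRot60 a ∼ kagomeRot60 b ↔ a ∼ b` in
`kagomeGraph`, by the finite verification behind Savary–Balents' Fig. 12 (the kagomé lattice is
invariant under the rotations of order `6` about a hexagon centre): writing `a = (x, s)`,
`b = (y, t)`, for each of the `9` sublattice pairs `(s, t)` both sides unfold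
(`kagomeGraph_adj_iff`, the table `KagomeAdjRel ℤ`, `kagomeRot60`, `R (x₀, x₁) = (-x₁, x₀ + x₁)`)
to the same linear-arithmetic condition on the coordinates `x₀, x₁, y₀, y₁ ∈ ℤ` (`omega`).
Geometrically: `kagomeRot60` maps the up triangle of the cell `x` onto the down triangle of the
cell `Rx - e₀` and the down triangle of `x` onto the up triangle of `Rx - e₀ + e₁`
(`R e₀ = e₁`, `R e₁ = e₁ - e₀`), and two kagome sites are adjacent iff they are distinct and share
an up or a down triangle. The bijectivity `kagomeRot60_bijective` is discharged in
`KagomeLattice.lean` itself (`kagomeRot60_bijective_holds`).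

## References

* L. Savary, L. Balents, *Quantum spin liquids: a review*, Rep. Prog. Phys. **80** (2017),
  016502, doi:10.1088/0034-4885/80/1/016502, arXiv:1601.03742, §6.4.2 (Kagomé models) and
  §7.1.1 (the kagomé lattice of corner-sharing triangles).
* W. Werner, *Lectures on two-dimensional critical percolation*, IAS/Park City (2009), §1
  (lattice coordinates of `𝕋` and its rotations).
-/

namespace Literature.MathematicalPhysics.QuantumLattice

open Literature.Probability.LatticeModels Literature.Probability.Percolation

/-- `R (x + e₀) = R x + e₁` for the `60°` rotation `R = triRot60` of `𝕋`. (Werner 2009, §1.) [cite: Werner2009, §1] -/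
theorem triRot60_add_single_zero (x : Site 2) :
    triRot60 (x + Pi.single 0 1) = triRot60 x + Pi.single 1 1 := by
  ext i
  fin_cases i
  · simp [triRot60]
  · simp only [Pi.add_apply]
    simp [triRot60]
    omega

/-- `R (x + e₁) = R x - e₀ + e₁` for the `60°` rotation `R = triRot60` of `𝕋`. (Werner 2009, §1.) [cite: Werner2009, §1] -/
theorem triRot60_add_single_one (x : Site 2) :
    triRot60 (x + Pi.single 1 1) = triRot60 x - Pi.single 0 1 + Pi.single 1 1 := by
  ext i
  fin_cases i <;> simp only [Pi.add_apply, Pi.sub_apply] <;> simp [triRot60] <;> omega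

/-- **`kagomeRot60` acts on edges of `𝕋` through `triRot60`** (`kagomeEdge_kagomeRot60` holds):
`kagomeEdge (kagomeRot60 v) = (kagomeEdge v).map triRot60` for every kagome site `v`, by the
three-case computation `{x, x + e₀} ↦ {Rx, Rx + e₁}`, `{x, x + e₁} ↦ {Rx, Rx - e₀ + e₁}`,
`{x + e₀, x + e₁} ↦ {Rx + e₁, Rx - e₀ + e₁}`. (Savary–Balents 2017, §6.4.2 of arXiv:1601.03742,
the kagomé lattice; Werner 2009, §1, the rotation `R`.) [cite: SavaryBalents2017, §6.4.2 (arXiv:1601.03742 p. 39)] -/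
theorem kagomeEdge_kagomeRot60_holds : kagomeEdge_kagomeRot60 := by
  rintro ⟨x, s⟩
  have h₂ : triRot60 x - Pi.single 0 1 + Pi.single 1 1 + Pi.single 0 1 =
      triRot60 x + Pi.single 1 1 := by
    abel
  fin_cases s
  · simp [kagomeEdge, kagomeRot60, triRot60_add_single_zero]
  · simp [kagomeEdge, kagomeRot60, triRot60_add_single_one]
  · simp only [kagomeEdge, kagomeRot60, Matrix.cons_val_zero, Matrix.cons_val,
      Fin.reduceFinMk, Sym2.map_mk, triRot60_add_single_zero, triRot60_add_single_one, h₂]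
    exact Sym2.eq_swap

/-- `e₀ = (1, 0)` in the `![…]` notation (coordinates of `Pi.single`). (Werner 2009, §1: lattice
coordinates of `𝕋`.) [cite: Werner2009, §1] -/
private theorem single_zero_eq_vec : (Pi.single (0 : Fin 2) (1 : ℤ) : Site 2) = ![1, 0] := by
  ext i; fin_cases i <;> rfl

/-- `e₁ = (0, 1)` in the `![…]` notation (coordinates of `Pi.single`). (Werner 2009, §1: lattice
coordinates of `𝕋`.) [cite: Werner2009, §1] -/
private theorem single_one_eq_vec : (Pi.single (1 : Fin 2) (1 : ℤ) : Site 2) = ![0, 1] := by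
  ext i; fin_cases i <;> rfl

/-- **`kagomeRot60` is a graph automorphism of the kagome lattice** (`kagomeGraph_adj_kagomeRot60_iff`
holds): `kagomeGraph.Adj (kagomeRot60 a) (kagomeRot60 b) ↔ kagomeGraph.Adj a b` for all kagome
sites `a, b`. Proof: case analysis over the sublattice pair `(a.2, b.2) ∈ Fin 3 × Fin 3`; in each
case both sides reduce, in the coordinates `a.1 = (x₀, x₁)`, `b.1 = (y₀, y₁)` and with
`R (x₀, x₁) = (-x₁, x₀ + x₁)`, to one and the same linear condition (decided by `omega`).
(Savary–Balents 2017, Fig. 12 and §6.4.2 of arXiv:1601.03742: the kagomé lattice and its sixfold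
symmetry about hexagon centres; Werner 2009, §1 for `R`; the source prints no proof of this
elementary lattice-geometry statement.) [cite: SavaryBalents2017, §6.4.2 (arXiv:1601.03742 p. 39)] -/
theorem kagomeGraph_adj_kagomeRot60_iff_holds : kagomeGraph_adj_kagomeRot60_iff := by
  rintro ⟨x, s⟩ ⟨y, t⟩
  fin_cases s <;> fin_cases t <;>
    simp [kagomeGraph_adj_iff, KagomeAdjRel, kagomeRot60, triRot60, funext_iff,
      Fin.forall_fin_two, single_zero_eq_vec, single_one_eq_vec, sub_eq_add_neg, Matrix.vecHead,
      Matrix.vecTail] <;>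
    omega

end Literature.MathematicalPhysics.QuantumLattice
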